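import Literature.Geometry.Riemannian.NonTrappingConvexSublevelProofs
import Literature.Geometry.Riemannian.HopfRinowCompact
import HarnessLib

/-!
# Geodesics and a function whose superlevel sets are strictly convex below a threshold

Support file for the discharge of
`Literature.Geometry.Riemannian.ggsu_boundary_sphere_of_nonTrapping_of_nonpos`
(`SimpleAHBoundarySphere.lean`). For a smooth Riemannian metric `g` (general model) and a smooth
function `φ` satisfying the **convexity hypothesis below `c₀`** — at every `x` with `φ x < c₀`,
`dφ_x ≠ 0` and `Hess^g φ_x (u,u) < 0` for non-zero `u ∈ ker dφ_x` (for `φ = ρ ∘ j` on an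
asymptotically hyperbolic end this is `exists_hessian_neg_near_infinity`) — every superlevel set
`{φ ≥ c}`, `c < c₀`, is a strictly convex sublevel domain `{c - φ ≤ 0}` in the sense of
`IsStrictlyConvexSublevel` (Paternain–Salo–Uhlmann 2023, Def. 3.1.7 / Lemma 3.1.12), so that the
tree's glancing/transversality lemmas apply. Consequences along a non-constant geodesic `γ`:
`φ ∘ γ` has no local minimum with value `< c₀` (`not_isLocalMin_comp_geodesic`), hence
`φ ∘ γ ≥ c` on `[a, b]` as soon as this holds at `a` and `b` (`le_comp_geodesic_of_endpoints`, the
"no dip" property), and level `c` is left transversally (`mvfderiv_velocity_neg_of_exit_level`).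
Everything is proved; no definitions, no named facts.

## References

* G. P. Paternain, M. Salo, G. Uhlmann, *Geometric Inverse Problems*, CUP 2023, Def. 3.1.7 and
  Lemma 3.1.12. [PaternainSaloUhlmann2023]
-/

noncomputable section

open Bundle Set Function Filter NormedSpace FiberBundle
open scoped Manifold ContDiff Topology

namespace Literature.Geometry.Riemannian.GGSU

open Literature.Geometry.Lorentzian
open Literature.Geometry.Lorentzian.PseudoRiemannianMetric

variable {E : Type*} [NormedAddCommGroup E] [NormedSpace ℝ E] {H : Type*} [TopologicalSpace H]
  {I : ModelWithCorners ℝ E H} {M : Type*} [TopologicalSpace M] [ChartedSpace H M]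
  [IsManifold I ∞ M] [FiniteDimensional ℝ E] [CompleteSpace E]
  {g : PseudoRiemannianMetric I ∞ E (TangentSpace I : M → Type _)} [g.HasLeviCivita]
  {φ : M → ℝ} {c₀ : ℝ}

omit [IsManifold I ∞ M] [FiniteDimensional ℝ E] [CompleteSpace E] in
/-- `d(c - φ) = -dφ` as covectors, for `φ` differentiable at `x`. [folklore] -/
theorem mvfderiv_const_sub {x : M} (hφ : MDiffAt φ x) (c : ℝ) :
    mvfderiv I (fun y ↦ c - φ y) x = - mvfderiv I φ x := by
  have : (fun y ↦ c - φ y) = (fun _ ↦ c) - φ := rfl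
  rw [this, mvfderiv_sub (mdifferentiableAt_const ..) hφ, mvfderiv_const, zero_sub]

/-- The Hessian of `c - φ` is minus the Hessian of `φ` (for smooth `φ`). [folklore] -/
theorem hessian_const_sub (hφ : CMDiff ∞ φ) (c : ℝ) (x : M) (v w : TangentSpace I x) :
    g.hessian (fun y ↦ c - φ y) x v w = - g.hessian φ x v w := by
  have hV : MDiffAt (T% (extend E v)) x := mdifferentiableAt_extend ..
  have hW : MDiffAt (T% (extend E w)) x := mdifferentiableAt_extend ..
  have h2 : (2 : ℕ∞ω) ≤ ∞ := WithTop.coe_le_coe.mpr le_top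
  have hφ2 : CMDiffAt 2 φ x := (hφ x).of_le h2
  have hφ2' : CMDiffAt 2 (fun y ↦ c - φ y) x := contMDiffAt_const.sub hφ2
  have h1 := g.hessian_apply_holds hφ2' hV hW
  have h1' := g.hessian_apply_holds hφ2 hV hW
  simp only [extend_apply_self] at h1 h1'
  rw [h1, h1']
  simp only [hessianAux]
  have hfun : (fun y ↦ mvfderiv I (fun y ↦ c - φ y) y (extend E w y)) =
      -fun y ↦ mvfderiv I φ y (extend E w y) := by
    funext y
    rw [mvfderiv_const_sub ((hφ y).mdifferentiableAt (by simp)) c]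
    rfl
  rw [hfun, mvfderiv_neg, mvfderiv_const_sub ((hφ x).mdifferentiableAt (by simp)) c]
  simp only [neg_apply]
  ring

/-- **The superlevel sets `{φ ≥ c}`, `c < c₀`, are strictly convex sublevel domains**
`{c - φ ≤ 0}` (`IsStrictlyConvexSublevel`), under the convexity hypothesis below `c₀`.
[cite: PaternainSaloUhlmann2023, Def. 3.1.7 and Lemma 3.1.12] -/
theorem isStrictlyConvexSublevel_const_sub (hφ : CMDiff ∞ φ)
    (hcvx : ∀ x, φ x < c₀ → mvfderiv I φ x ≠ 0 ∧
      ∀ u : TangentSpace I x, u ≠ 0 → mvfderiv I φ x u = 0 → g.hessian φ x u u < 0)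
    {c : ℝ} (hc : c < c₀) : IsStrictlyConvexSublevel g (fun y ↦ c - φ y) := by
  refine ⟨fun x hx h0 ↦ ?_, fun x hx v hv hdv ↦ ?_⟩
  · have hφx : φ x < c₀ := by linarith
    apply (hcvx x hφx).1
    have h1 := mvfderiv_const_sub (I := I) ((hφ x).mdifferentiableAt (by simp)) c
    have h2 : mvfderiv I (fun y ↦ c - φ y) x = 0 := by
      ext u
      simp only [mvfderiv, h0, ContinuousLinearMap.coe_comp, Function.comp_apply,
        zero_apply, map_zero]
    rw [h2] at h1
    exact (neg_eq_zero.1 h1.symm)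
  · have hφx : φ x < c₀ := by linarith
    have hdv' : mvfderiv I φ x v = 0 := by
      have h1 := congrArg (fun L ↦ L v) (mvfderiv_const_sub (I := I)
        ((hφ x).mdifferentiableAt (by simp)) c)
      simp only [neg_apply] at h1
      have : mvfderiv I (fun y ↦ c - φ y) x v = 0 := hdv
      rw [this] at h1
      linarith
    rw [hessian_const_sub hφ]
    linarith [(hcvx x hφx).2 v hv hdv']

/-- **No local minimum below the threshold.** Along a non-constant geodesic `γ`, the function
`φ ∘ γ` has no local minimum at a parameter `t` with `φ (γ t) < c₀` (at such a minimum `γ` is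
tangent to the level set `{φ = φ (γ t)}`, which it then leaves strictly to the side `{φ < φ (γ t)}`
by strict convexity, `IsStrictlyConvexSublevel.eventually_pos_of_tangent`).
[cite: PaternainSaloUhlmann2023, Lemma 3.1.12] -/
theorem not_isLocalMin_comp_geodesic (hg : g.IsRiemannian) (hφ : CMDiff ∞ φ)
    (hcvx : ∀ x, φ x < c₀ → mvfderiv I φ x ≠ 0 ∧
      ∀ u : TangentSpace I x, u ≠ 0 → mvfderiv I φ x u = 0 → g.hessian φ x u u < 0)
    {γ : ℝ → M} (hγ : IsGeodesic g.leviCivita γ) {t₁ : ℝ}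
    (hv : velocity I γ t₁ ≠ 0) {t : ℝ} (ht : φ (γ t) < c₀)
    (hmin : IsLocalMin (fun s ↦ φ (γ s)) t) : False := by
  set c := φ (γ t) with hc
  have hcon := isStrictlyConvexSublevel_const_sub hφ hcvx ht
  have hvt : velocity I γ t ≠ 0 := hγ.velocity_ne_zero g hg hv t
  have h2 : (2 : ℕ∞ω) ≤ ∞ := WithTop.coe_le_coe.mpr le_top
  have hsm : ∀ s ∈ (univ : Set ℝ), CMDiffAt 2 (fun y ↦ c - φ y) (γ s) := fun s _ ↦
    contMDiffAt_const.sub ((hφ _).of_le h2)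
  -- `(φ ∘ γ)'(t) = 0`
  have hD : HasDerivAt (fun s ↦ φ (γ s)) (mvfderiv I φ (γ t) (velocity I γ t)) t :=
    hasDerivAt_comp_curve_mvfderiv ((hφ _).mdifferentiableAt (by simp))
      (IsGeodesicOn.mdifferentiableAt_holds hγ (mem_univ t))
  have h0' : mvfderiv I φ (γ t) (velocity I γ t) = 0 := hmin.hasDerivAt_eq_zero hD
  have hd : mfderiv I 𝓘(ℝ, ℝ) (fun y ↦ c - φ y) (γ t) (velocity I γ t) = 0 := by
    have h1 := congrArg (fun L ↦ L (velocity I γ t)) (mvfderiv_const_sub (I := I)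
      ((hφ (γ t)).mdifferentiableAt (by simp)) c)
    simp only [neg_apply, h0', neg_zero] at h1
    exact h1
  have hev := hcon.eventually_pos_of_tangent hγ isOpen_univ (mem_univ t) hsm (by simp [hc]) hd hvt
  have hmin' : ∀ᶠ s in 𝓝[≠] t, φ (γ t) ≤ φ (γ s) := nhdsWithin_le_nhds hmin
  obtain ⟨s, hs1, hs2⟩ := (hev.and hmin').exists
  simp only [hc] at hs1
  linarith

/-- **No dip below a level `c < c₀`.** If `φ ∘ γ ≥ c` at `a` and at `b` (`a ≤ b`, `c < c₀`) along a
non-constant geodesic, then `φ ∘ γ ≥ c` on `[a, b]` (a parameter with a smaller value would give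
an interior minimum below `c₀`). [cite: PaternainSaloUhlmann2023, Lemma 3.1.12] -/
theorem le_comp_geodesic_of_endpoints (hg : g.IsRiemannian) (hφ : CMDiff ∞ φ)
    (hcvx : ∀ x, φ x < c₀ → mvfderiv I φ x ≠ 0 ∧
      ∀ u : TangentSpace I x, u ≠ 0 → mvfderiv I φ x u = 0 → g.hessian φ x u u < 0)
    {γ : ℝ → M} (hγ : IsGeodesic g.leviCivita γ) {t₁ : ℝ}
    (hv : velocity I γ t₁ ≠ 0) {a b c : ℝ} (hc : c < c₀) (ha : c ≤ φ (γ a))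
    (hb : c ≤ φ (γ b)) : ∀ t ∈ Icc a b, c ≤ φ (γ t) := by
  by_contra hcon
  push Not at hcon
  obtain ⟨t, ht, hlt⟩ := hcon
  have hcont : ContinuousOn (fun s ↦ φ (γ s)) (Icc a b) :=
    (hφ.continuous.comp (hγ.continuous)).continuousOn
  obtain ⟨t₀, ht₀, hmin⟩ := (isCompact_Icc (a := a) (b := b)).exists_isMinOn ⟨t, ht⟩ hcont
  have hlt₀ : φ (γ t₀) < c := lt_of_le_of_lt (hmin ht) hlt
  have hne_a : t₀ ≠ a := fun h ↦ by rw [h] at hlt₀; linarith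
  have hne_b : t₀ ≠ b := fun h ↦ by rw [h] at hlt₀; linarith
  have hint : Icc a b ∈ 𝓝 t₀ :=
    Icc_mem_nhds (lt_of_le_of_ne ht₀.1 (Ne.symm hne_a)) (lt_of_le_of_ne ht₀.2 hne_b)
  exact not_isLocalMin_comp_geodesic hg hφ hcvx hγ hv (by linarith) (hmin.isLocalMin hint)

/-- **Levels `c < c₀` are left transversally.** If `φ ∘ γ ≥ c` on `[a, t₀]` (`a < t₀`) and
`φ (γ t₀) = c < c₀` along a non-constant geodesic, then `(φ ∘ γ)'(t₀) = dφ(γ' t₀) < 0`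
(`IsStrictlyConvexSublevel.mvfderiv_velocity_pos_of_exit` for `{c - φ ≤ 0}`).
[cite: PaternainSaloUhlmann2023, Lemma 3.1.12] -/
theorem mvfderiv_velocity_neg_of_exit_level (hg : g.IsRiemannian) (hφ : CMDiff ∞ φ)
    (hcvx : ∀ x, φ x < c₀ → mvfderiv I φ x ≠ 0 ∧
      ∀ u : TangentSpace I x, u ≠ 0 → mvfderiv I φ x u = 0 → g.hessian φ x u u < 0)
    {γ : ℝ → M} (hγ : IsGeodesic g.leviCivita γ)
    {t₁ : ℝ} (hv : velocity I γ t₁ ≠ 0) {a t₀ c : ℝ} (hat : a < t₀) (hc : c < c₀)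
    (hin : ∀ t ∈ Icc a t₀, c ≤ φ (γ t)) (h0 : φ (γ t₀) = c) :
    mvfderiv I φ (γ t₀) (velocity I γ t₀) < 0 := by
  have hcon := isStrictlyConvexSublevel_const_sub hφ hcvx hc
  have h2 : (2 : ℕ∞ω) ≤ ∞ := WithTop.coe_le_coe.mpr le_top
  have hsm : ∀ s ∈ (univ : Set ℝ), CMDiffAt 2 (fun y ↦ c - φ y) (γ s) := fun s _ ↦
    contMDiffAt_const.sub ((hφ _).of_le h2)
  have hpos := hcon.mvfderiv_velocity_pos_of_exit hγ isOpen_univ hat (subset_univ _) hsm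
    (fun t ht ↦ by linarith [hin t ht]) (by simp [h0]) (hγ.velocity_ne_zero g hg hv t₀)
  have h1 := congrArg (fun L ↦ L (velocity I γ t₀)) (mvfderiv_const_sub (I := I)
    ((hφ (γ t₀)).mdifferentiableAt (by simp)) c)
  simp only [neg_apply] at h1
  rw [h1] at hpos
  linarith

end Literature.Geometry.Riemannian.GGSU
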